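import Mathlib
import HarnessLib
import Literature.Analysis.FluidPDE.LerayHopfTimeSlice
import Summits.NavierStokesRegularity.NavierStokesRegularity.Theorems.CertifiedBlowupCertifiedBlowupAxisymBlowupNoExtinction

/-!
# RootDecompLitSlice — crux `NoDarkBall` (stmt-NavierStokesRegularity-29563), registered stub
  `stub_noGlobalExtinction` (= aside item `NoGlobalExtinction`, stmt-NavierStokesRegularity-29567)

**The terminal slice of a first blow-up is not globally extinct.** For a maximal smooth solution
`(u, p)` of lifespan `T > 0` (viscosity `ν > 0`, zero force) on `ℝ³`, Leray–Hopf on `[0, T]` from its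
rapidly decaying datum `u 0`, the terminal slice `u T` (pinned a.e. by the weak `L²` continuity of the
Leray–Hopf class) is NOT a.e. zero. Registered stub `stub_noGlobalExtinction` of the birth skeleton
`NoDarkBall_of : DarkBallSpreads → NoGlobalExtinction → NoDarkBall` (lens-6 / writer g11), landed
`--supports stmt-NavierStokesRegularity-29563`; the statement is verbatim the registered signature.

Proof, from PROVED theorems of the tree only:
* weak `L²` continuity on `(0, T]` (`IsLerayHopfOn.weak_continuous`) and `u T = 0` a.e. give
  `∫⟪u(t), φ⟫ → 0` as `t ↑ T` for every test field `φ` (`tendsto_integral_inner_of_dark`);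
* backward uniqueness for classical Leray–Hopf solutions from rapidly decaying data
  (`Theorems.CertifiedBlowupAxisymBlowup.CompactAmplification.eq_zero_of_tendsto_zero_of_lerayHopf_classical`:
  Lemarié-Rieusset 2016 Thm. 15.4 after Escauriaza–Seregin–Šverák 2003, via the tree's discharged
  `lemarieRieusset_backward_uniqueness_slab_holds`; the solution is local Leray on the full slab)
  gives `u ≡ 0` on `(0, T) × ℝ³`;
* so `u` is bounded on `[0, T) × ℝ³` (the datum by its decay constant), and bounded Leray–Hopf
  classical solutions continue past `T` (`hasSmoothExtensionPast_of_bounded_holds`), contradicting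
  maximality — exactly as in the landed axisymmetric sibling
  `not_tendsto_zero_of_isMaximalSmoothSolution` (crux 0727), whose symmetry hypothesis is idle.
Alone this evicts every Navier–Stokes-inequality blow-up in print (all globally energy-extinct at the
singular time) from the dark cells of the route. The crux `NoDarkBall` itself still needs
`stub_darkBallSpreads` (CKN slice nullity + space-like unique continuation, L). Navier–Stokes
regularity is NOT proved by anything here. decomp-ns writer g13.
[cite: LemarieRieusset2016, Thm. 15.4 (p. 568)] [cite: EscauriazaSereginSverak2003, Thm. 1.4 and §5]
-/

-- the summit and its single sub-problem share the name (CONVENTIONS §1), as in every Theorems file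
set_option linter.dupNamespace false

noncomputable section

open MeasureTheory Set Filter Topology Function Metric
open scoped ENNReal NNReal RealInnerProductSpace

namespace Summit.NavierStokesRegularity.NavierStokesRegularity.Theorems.NoDarkBall

open Literature.Analysis.FluidPDE

/-- **A dark terminal slice is a weak-`𝒟'` limit `0`.** If `u` is Leray–Hopf on `[0, T]`, `T > 0`,
and `u T = 0` a.e., then `∫⟪u(t), φ⟫ → 0` as `t ↑ T` for every test field `φ`: weak `L²` continuity
of the Leray–Hopf class on `(0, T]` at `t = T`, the limit pairing vanishing. [folklore] -/
theorem tendsto_integral_inner_of_dark {ν T : ℝ} (hT : 0 < T)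
    {u : ℝ → EuclideanSpace ℝ (Fin 3) → EuclideanSpace ℝ (Fin 3)} (hLH : IsLerayHopfOn T ν 0 (u 0) u)
    (hdark : ∀ᵐ x ∂(volume : Measure (EuclideanSpace ℝ (Fin 3))), u T x = 0)
    (φ : EuclideanSpace ℝ (Fin 3) → EuclideanSpace ℝ (Fin 3))
    (hφ : Literature.Analysis.FunctionSpaces.IsTestFunctionOn
      (⊤ : TopologicalSpace.Opens (EuclideanSpace ℝ (Fin 3))) φ) :
    Tendsto (fun t => ∫ x, inner ℝ (u t x) (φ x)) (𝓝[<] T) (𝓝 0) := by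
  have hcont := (hLH.weak_continuous φ (hφ.memLp_volume 2)).1
  have hzero : ∫ x, inner ℝ (u T x) (φ x) = 0 := by
    have hae : (fun x => inner ℝ (u T x) (φ x)) =ᵐ[volume] fun _ => (0 : ℝ) :=
      hdark.mono fun x hx => by simp [hx]
    rw [integral_congr_ae hae, integral_zero]
  have h1 : Tendsto (fun t => ∫ x, inner ℝ (u t x) (φ x)) (𝓝[Ioc 0 T] T)
      (𝓝 (∫ x, inner ℝ (u T x) (φ x))) := (hcont T ⟨hT, le_rfl⟩).tendsto
  rw [hzero] at h1
  have h2 := h1.mono_left (nhdsWithin_mono T (Ioo_subset_Ioc_self : Ioo 0 T ⊆ Ioc 0 T))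
  rwa [nhdsWithin_Ioo_eq_nhdsLT hT] at h2

/-- **Registered stub `stub_noGlobalExtinction` of crux `NoDarkBall` (stmt-NavierStokesRegularity-29563)
— no global extinction at a first blow-up time** (verbatim the registered signature; Lemarié-Rieusset
2016 Thm. 15.4 = backward uniqueness for local Leray solutions after Escauriaza–Seregin–Šverák 2003,
plus continuation of bounded solutions). [cite: LemarieRieusset2016, Thm. 15.4 (p. 568)] -/
theorem stub_noGlobalExtinction : ∀ (ν T : ℝ), 0 < ν → 0 < T → ∀ (u : ℝ → EuclideanSpace ℝ (Fin 3) → EuclideanSpace ℝ (Fin 3)) (p : ℝ → EuclideanSpace ℝ (Fin 3) → ℝ), Literature.Analysis.FluidPDE.IsMaximalSmoothSolution ν 0 u p T → Literature.Analysis.FluidPDE.IsLerayHopfOn T ν 0 (u 0) u → Literature.Analysis.FluidPDE.HasRapidSpatialDecay (u 0) → ¬ (∀ᵐ x ∂(MeasureTheory.volume : MeasureTheory.Measure (EuclideanSpace ℝ (Fin 3))), u T x = 0) := by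
  intro ν T hν hT u p hmax hLH hdec hdark
  -- the dark slice is a weak limit `0`, so backward uniqueness empties the open strip
  have hzero := CertifiedBlowupAxisymBlowup.CompactAmplification.eq_zero_of_tendsto_zero_of_lerayHopf_classical
    hν hT hmax.1 hLH hdec (fun φ hφ => tendsto_integral_inner_of_dark hT hLH hdark φ hφ)
  -- the datum is bounded by its decay constant, the later slices vanish
  obtain ⟨C₀, hC₀⟩ := hdec 0 0
  have hC₀' : ∀ x, ‖u 0 x‖ ≤ C₀ := fun x => by
    have h1 := hC₀ x
    rwa [pow_zero, one_mul, norm_iteratedFDeriv_zero] at h1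
  -- bounded Leray–Hopf classical solutions continue past `T`: contradiction with maximality
  refine hmax.2 (hasSmoothExtensionPast_of_bounded_holds hν hT hmax.1 hLH ⟨C₀, fun t ht x => ?_⟩)
  rcases ht.1.eq_or_lt with h0 | hpos
  · rw [← h0]
    exact hC₀' x
  · rw [hzero t ⟨hpos, ht.2⟩ x, norm_zero]
    exact (norm_nonneg _).trans (hC₀' 0)

end Summit.NavierStokesRegularity.NavierStokesRegularity.Theorems.NoDarkBall

end
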